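import Mathlib
import Literature.Probability.LatticeModels.ConformalCovariance
import Literature.Probability.LatticeModels.ScalingLimit
import Literature.Probability.LatticeModels.IsingThermodynamics
import HarnessLib

/-!
# Strategist p1 (wall-breaker) census artefacts — crux stmt-CriticalPhenomena-4801 `MoebiusLimitOfTwoPointLaw`

Typed companions of `STRATEGY-CENSUS.md` (p1 edition), §Transfer T-P4 ("radial regularisation trades ι for τ")
and §Strengthen S-P1 ("summable scale defect"). Nothing here is a line or a stub of the crux; these are the
kernel-checked forms of two census claims:

* `moebius_of_radial_and_oneTranslation` — the MIRROR IMAGE of the parabolic-maximality remark (s2 Transfer 5):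
  a family covariant under the symmetries that are EXACT for an `S² × ℤ` (radially quantised) regularisation —
  rotations about the axis point, dilations (the mesh trick along the axis), the unit inversion (`t ↦ −t`) — and
  under ONE non-zero translation is Möbius covariant. So for a radially regularised critical Ising model the
  whole conformal problem is "one translation", exactly as for `ℤ³` it is "one inversion".
* `not_modelBlindRadialTranslationUpgrade` — and model-blindly that missing generator is as unconstrained as `ι`
  is for the flat regularisation (`Literature.Barriers.CriticalPhenomena.ScaleCovarianceNotMoebius`): an explicit
  rotation-invariant, scale- and inversion-covariant, continuous-off-zero family that is not translation invariant.
* `SummableScaleDefect` — the typed form of the Kozma-type (3D LERW) "Cauchy across dyadic scales" strengthening of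
  the existence half D₂; recorded as a `def` only (it is strictly stronger than D₂ and carries no engine).
-/

noncomputable section

namespace Summit.CriticalPhenomena.Ising3DConformalLimit.Cruxes.MoebiusLimitOfTwoPointLaw.StrategistCensusP1

open Literature.Probability.LatticeModels Filter Topology

/-- Points of `ℝ³`. -/
abbrev E3 : Type := EuclideanSpace ℝ (Fin 3)

/-- Invariance under ONE translation `v`. -/
def IsOneTranslationInvariant (v : E3) (S : CorrFamily 3) : Prop :=
  ∀ n (x : Fin n → E3), S n (fun i => x i + v) = S n x

/-- **One translation generates all of them** given rotations (reflections included) and dilations: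
`w = R (λ v)` with `λ = ‖w‖/‖v‖` and `R` the reflection exchanging `λv` and `w`. [folklore] -/
theorem translationInvariant_of_one {v : E3} (hv : v ≠ 0) {Δ : ℝ} {S : CorrFamily 3}
    (hR : IsRotationInvariant S) (hD : IsScaleCovariant Δ S) (hT : IsOneTranslationInvariant v S) :
    IsTranslationInvariant S := by
  intro n w x
  by_cases hw : w = 0
  · simp [hw]
  set lam : ℝ := ‖w‖ / ‖v‖ with hlam
  have hvn : 0 < ‖v‖ := norm_pos_iff.mpr hv
  have hwn : 0 < ‖w‖ := norm_pos_iff.mpr hw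
  have hlam_pos : 0 < lam := div_pos hwn hvn
  set u : E3 := lam • v with hu
  have hnorm : ‖u‖ = ‖w‖ := by
    rw [hu, norm_smul, Real.norm_eq_abs, abs_of_pos hlam_pos, hlam, div_mul_cancel₀ _ hvn.ne']
  set R : E3 ≃ₗᵢ[ℝ] E3 := (ℝ ∙ (u - w))ᗮ.reflection with hRdef
  have hRu : R u = w := Submodule.reflection_sub hnorm
  -- both sides equal `lam^(-nΔ) * S n (fun i => lam⁻¹ • R.symm (x i))`
  have key : ∀ y : Fin n → E3, S n y = lam ^ (-(n : ℝ) * Δ) * S n (fun i => lam⁻¹ • R.symm (y i)) := by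
    intro y
    have h1 : S n y = S n (fun i => R.symm (y i)) := (hR n R.symm y).symm
    have h2 : (fun i => R.symm (y i)) = fun i => lam • (lam⁻¹ • R.symm (y i)) := by
      funext i; rw [smul_smul, mul_inv_cancel₀ hlam_pos.ne', one_smul]
    rw [h1, h2, hD n lam hlam_pos]
  have lhs : S n (fun i => x i + w) = lam ^ (-(n : ℝ) * Δ) * S n (fun i => lam⁻¹ • R.symm (x i)) := by
    rw [key]
    congr 1
    have h3 : (fun i => lam⁻¹ • R.symm (x i + w)) = fun i => lam⁻¹ • R.symm (x i) + v := by
      funext i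
      have : R.symm w = u := by rw [← hRu]; exact R.symm_apply_apply u
      rw [map_add, this, hu, smul_add, smul_smul, inv_mul_cancel₀ hlam_pos.ne', one_smul]
    rw [h3]
    exact hT n _
  rw [lhs, ← key x]

/-- **Radial group lemma.** Rotation invariance + scale covariance + unit-inversion covariance (the symmetries exact,
after the mesh trick, for an `S² × ℤ` regularisation about the origin) + invariance under ONE non-zero translation
give Möbius covariance. [folklore] -/
theorem moebius_of_radial_and_oneTranslation {v : E3} (hv : v ≠ 0) {Δ : ℝ} {S : CorrFamily 3}
    (hR : IsRotationInvariant S) (hD : IsScaleCovariant Δ S) (hI : IsInversionCovariant Δ S)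
    (hT : IsOneTranslationInvariant v S) : IsMoebiusCovariant Δ S :=
  ⟨⟨translationInvariant_of_one hv hR hD hT, hR⟩, hD, hI⟩

/-! ### The missing generator of the radial regularisation is model-blindly free -/

/-- The model-blind "radial translation upgrade": every rotation-invariant, scale- and inversion-covariant family that
is continuous off the origin/diagonals and has a positive two-point function off the origin is translation invariant.
(The radial mirror image of `Literature.Barriers.CriticalPhenomena.ScaleCovarianceNotMoebius`'s upgrade.) -/
def ModelBlindRadialTranslationUpgrade : Prop :=
  ∀ (Δ : ℝ) (S : CorrFamily 3), 0 < Δ → IsRotationInvariant S → IsScaleCovariant Δ S →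
    IsInversionCovariant Δ S → (∀ x y : E3, x ≠ 0 → y ≠ 0 → x ≠ y → 0 < S 2 ![x, y]) →
    IsTranslationInvariant S

/-- Witness: `S₂(x,y) = (‖x‖‖y‖)^{-Δ}`, all other arities `0`. -/
def radialWitness (Δ : ℝ) : CorrFamily 3 := fun n =>
  if h : n = 2 then fun x => (‖x ⟨0, by omega⟩‖ * ‖x ⟨1, by omega⟩‖) ^ (-Δ) else fun _ => 0

theorem radialWitness_two (Δ : ℝ) (x : Fin 2 → E3) :
    radialWitness Δ 2 x = (‖x 0‖ * ‖x 1‖) ^ (-Δ) := by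
  simp [radialWitness]

theorem radialWitness_ne_two (Δ : ℝ) {n : ℕ} (hn : n ≠ 2) (x : Fin n → E3) : radialWitness Δ n x = 0 := by
  simp [radialWitness, hn]

theorem radialWitness_isRotationInvariant (Δ : ℝ) : IsRotationInvariant (radialWitness Δ) := by
  intro n R x
  by_cases hn : n = 2
  · subst hn; simp [radialWitness_two]
  · simp [radialWitness_ne_two Δ hn]

theorem radialWitness_isScaleCovariant (Δ : ℝ) : IsScaleCovariant Δ (radialWitness Δ) := by
  intro n c hc x
  by_cases hn : n = 2
  · subst hn
    simp only [radialWitness_two, norm_smul, Real.norm_eq_abs, abs_of_pos hc]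
    have hp : 0 ≤ ‖x 0‖ * ‖x 1‖ := by positivity
    rw [show c * ‖x 0‖ * (c * ‖x 1‖) = c ^ (2:ℕ) * (‖x 0‖ * ‖x 1‖) by ring,
      Real.mul_rpow (by positivity) hp, ← Real.rpow_natCast c 2, ← Real.rpow_mul hc.le]
    congr 1
    push_cast
    ring_nf
  · simp [radialWitness_ne_two Δ hn]

/-- `‖ι y‖ = ‖y‖⁻¹` for the unit inversion (Mathlib's junk value `ι 0 = 0` makes it hold at `0` too). -/
theorem norm_inversion_zero_one (y : E3) : ‖EuclideanGeometry.inversion 0 1 y‖ = ‖y‖⁻¹ := by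
  have h := EuclideanGeometry.dist_inversion_center (0 : E3) y 1
  rw [dist_zero_right, dist_zero_right] at h
  rw [h]; simp [one_div]

theorem radialWitness_isInversionCovariant (Δ : ℝ) : IsInversionCovariant Δ (radialWitness Δ) := by
  intro n x hx
  by_cases hn : n = 2
  · subst hn
    simp only [radialWitness_two]
    have n0 : 0 < ‖x 0‖ := norm_pos_iff.mpr (hx 0)
    have n1 : 0 < ‖x 1‖ := norm_pos_iff.mpr (hx 1)
    rw [norm_inversion_zero_one (x 0), norm_inversion_zero_one (x 1), Fin.prod_univ_two]
    have hp : 0 < ‖x 0‖ * ‖x 1‖ := mul_pos n0 n1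
    rw [← mul_inv, Real.inv_rpow hp.le, ← Real.rpow_neg hp.le, neg_neg,
      ← Real.mul_rpow n0.le n1.le, ← Real.rpow_add hp]
    ring_nf
  · simp [radialWitness_ne_two Δ hn]

theorem radialWitness_twoPoint_pos (Δ : ℝ) {x y : E3} (hx : x ≠ 0) (hy : y ≠ 0) :
    0 < radialWitness Δ 2 ![x, y] := by
  rw [radialWitness_two]
  exact Real.rpow_pos_of_pos (mul_pos (norm_pos_iff.mpr (by simpa using hx)) (norm_pos_iff.mpr (by simpa using hy))) _

/-- The unit vector `e₀`. -/
def e0 : E3 := EuclideanSpace.single 0 1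

theorem norm_e0 : ‖e0‖ = 1 := by simp [e0]

theorem e0_ne_zero : e0 ≠ 0 := by
  intro h; have := norm_e0; rw [h, norm_zero] at this; exact zero_ne_one this

theorem radialWitness_not_isTranslationInvariant {Δ : ℝ} (hΔ : 0 < Δ) :
    ¬ IsTranslationInvariant (radialWitness Δ) := by
  intro h
  -- compare the pair (e₀, 2e₀) with its translate by e₀, i.e. (2e₀, 3e₀)
  have key := h 2 e0 ![e0, (2:ℝ) • e0]
  have lhs : radialWitness Δ 2 (fun i => (![e0, (2:ℝ) • e0] : Fin 2 → E3) i + e0) = (6:ℝ) ^ (-Δ) := by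
    rw [radialWitness_two]
    have h0 : (![e0, (2:ℝ) • e0] : Fin 2 → E3) 0 + e0 = (2:ℝ) • e0 := by simp [two_smul]
    have h1 : (![e0, (2:ℝ) • e0] : Fin 2 → E3) 1 + e0 = (3:ℝ) • e0 := by
      simp only [Matrix.cons_val_one, Matrix.cons_val_zero]
      rw [show (3:ℝ) • e0 = (2:ℝ) • e0 + (1:ℝ) • e0 by rw [← add_smul]; norm_num, one_smul]
    simp only [h0, h1, norm_smul, Real.norm_eq_abs, norm_e0, mul_one]
    norm_num
  have rhs : radialWitness Δ 2 (![e0, (2:ℝ) • e0] : Fin 2 → E3) = (2:ℝ) ^ (-Δ) := by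
    rw [radialWitness_two]
    simp [norm_smul, norm_e0]
  rw [lhs, rhs] at key
  have h6 : (6:ℝ) ^ (-Δ) < (2:ℝ) ^ (-Δ) :=
    Real.rpow_lt_rpow_of_neg (by norm_num) (by norm_num) (by linarith)
  exact absurd key h6.ne

/-- **The radial translation upgrade is false model-blindly.** [folklore] -/
theorem not_modelBlindRadialTranslationUpgrade : ¬ ModelBlindRadialTranslationUpgrade := by
  intro h
  have hT := h 1 (radialWitness 1) one_pos (radialWitness_isRotationInvariant 1)
    (radialWitness_isScaleCovariant 1) (radialWitness_isInversionCovariant 1)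
    (fun x y hx hy _ => radialWitness_twoPoint_pos 1 hx hy)
  exact radialWitness_not_isTranslationInvariant one_pos hT

/-! ### S-P1: the Kozma-type strengthening of the existence half, typed only -/

/-- `SummableScaleDefect Δ`: along the dyadic meshes `2^{-k}` the canonically renormalised critical correlators of
even arity `n ≥ 4` form a uniformly-Cauchy sequence with SUMMABLE increments on every compact set of non-coincident
configurations. Strictly stronger than dyadic existence D₂ (Cauchy ⇒ convergent), strictly weaker than a rate; by
the exact mesh identity `S^{δ/2}_n(x) = 2^{nΔ} S^{δ}_n(2x)` it is "finite-mesh ×2-covariance with a summable defect".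
Recorded, not proposed: no Ising engine gives summability (0634 carries no rate even at arity 2). -/
def SummableScaleDefect (Δ : ℝ) : Prop :=
  ∀ n, 4 ≤ n → Even n → ∀ K : Set (Fin n → E3), IsCompact K → K ⊆ NonCoincident 3 n →
    Summable fun k : ℕ => sSup ((fun x => |rescaledCorrelator (criticalCorr 3) (fun δ => δ ^ (-Δ)) n
      (((2:ℝ) ^ (k + 1))⁻¹) x - rescaledCorrelator (criticalCorr 3) (fun δ => δ ^ (-Δ)) n (((2:ℝ) ^ k)⁻¹) x|) '' K)

end Summit.CriticalPhenomena.Ising3DConformalLimit.Cruxes.MoebiusLimitOfTwoPointLaw.StrategistCensusP1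

end
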